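import Summits.HodgeConjecture.HodgeConjecture.Theorems.AnchorTransportAnchorExistenceK3SquareCMFloorSignatureReal
import Literature.AlgebraicGeometry.Hyperkaehler.K3HilbertType

/-!
# Route MarkmanPartnerTransport · support `PartnerExistence` (stmt-HodgeConjecture-19655) —
# the `K3^{[2]}` lattice `Λ_K3 ⊕ ⟨−2⟩` has at most THREE positive directions over `ℝ`

The real signature input of every argument about the Beauville–Bogomolov form of a marked projective
`K3^{[2]}`-type fourfold `(X, φ, P, z)` (marking lattice `Λ' = Λ_K3 ⊕ ⟨−2⟩ = E₈(−1)² ⊕ U³ ⊕ ⟨−2⟩`, the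
tree's `k3HilbertGram 2`, signature `(3, 20)`, Beauville 1983 Thm. 5 (a)): **a real subspace of
`Λ' ⊗ ℝ = ℝ²³` on which the form is positive semi-definite has dimension `≤ 3`.** This is the step that
turns the Hodge index theorem for the Lefschetz form `∫ κ² y y'` (tree:
`KaehlerRationalDatum.sigPos_sigNeg_lefschetzForm_restrict_neronSeveri_of_pos`) and the polarised Fujiki
relation (tree: `cupFour_eq_of_isMarkedK3Hilb`) into `q(κ) > 0` and the non-degeneracy of `q` on `N¹(X)`
(evidence #2 on stmt-HodgeConjecture-19655, steps 3–4: were `q(κ) < 0`, the `q`-orthogonal of `κ` in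
`NS(X)_ℝ` together with `Re z`, `Im z` would be a positive definite real subspace of dimension
`ρ(X) + 1 ≥ 5`). Proof: Sylvester by hand, as in the tree's `AnchorExistenceCMFloor.k3FormR_self_neg_of_orthogonal`
for `Λ_K3` — the `20`-dimensional subspace `{t : t|_Λ ∈ ker negMap}` (`E₈(−1)²_ℝ ⊕ ⟨e_k − f_k⟩ ⊕ ⟨δ⟩`) is
negative definite (`k3FormR_self_of_mem_ker`, `δ² = −2`), a positive semi-definite subspace meets it
trivially, and `dim + 20 ≤ 23`.

* `k3HilbertFormR_self_eq` — `(t.t)_{Λ'} = (t|_Λ . t|_Λ)_Λ − 2 t_δ²` for the real form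
  `Matrix.toBilin' ((k3HilbertGram 2).map Int.cast)` (no new definition: the form is this term).
* `finrank_le_three_of_nonneg` — **`dim_ℝ W ≤ 3` for every real subspace `W` with `(t.t) ≥ 0` on `W`.**
* `k3HilbertFormR_self_neg_of_orthogonal` — the form is negative definite on the orthogonal complement of
  three pairwise orthogonal positive vectors; `not_four_orthogonal_pos_real` — no four pairwise
  orthogonal positive vectors.
* `k3HilbertForm_realCast` — the complex form `k3HilbertForm 2` on real vectors is this real form.

No definition, no sorry, no named fact; route-independent (no `Theses` import). Prover seat
hodge-nonav-19652-p1 (gen 5), `--supports stmt-HodgeConjecture-19655`.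

References: A. Beauville, J. Differential Geom. 18 (1983) §8 Thm. 5 (a), §9 Rem. 1; D. Huybrechts,
*Lectures on K3 surfaces*, Ch. 1 Prop. 3.5; S. Lang, *Linear Algebra*, Ch. V §8 (Sylvester).
-/

noncomputable section

set_option linter.dupNamespace false

open Module
open Literature.AlgebraicGeometry.Surfaces Literature.AlgebraicGeometry.Hyperkaehler
open Summit.HodgeConjecture.HodgeConjecture.Theorems.AnchorExistenceCMFloor

namespace Summit.HodgeConjecture.HodgeConjecture.Theorems.MarkmanPartnerTransport.PartnerExistenceSignature

/-- `qR` = the real Beauville–Bogomolov form of `K3^{[2]}`-type on `ℝ²³`, `Matrix.toBilin'` of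
`k3HilbertGram 2`. Local notation only. -/
local notation3 (prettyPrint := false) "qR" => Matrix.toBilin' (Matrix.map (k3HilbertGram 2) (Int.cast : ℤ → ℝ))

/-- `NΛ'` = the negative definite `20`-space `{t : t|_Λ ∈ ker negMap}`. Local notation only. -/
local notation3 (prettyPrint := false) "NΛ'" => LinearMap.ker (negMap ∘ₗ LinearMap.funLeft ℝ ℝ (Sum.inl : K3Index → K3HilbertIndex))

/-! ### The form in blocks -/

/-- The defining double sum of the real `K3^{[2]}` form. [folklore] -/
theorem k3HilbertFormR_apply (a b : K3HilbertIndex → ℝ) :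
    qR a b = ∑ i, ∑ j, a i * (k3HilbertGram 2 i j : ℝ) * b j := by
  rw [Matrix.toBilin'_apply]
  rfl

/-- **Block expansion `Λ' = Λ_K3 ⊕ ⟨−2⟩`:** `(a.b)_{Λ'} = (a|_Λ . b|_Λ)_Λ − 2 a_δ b_δ`.
[cite: Beauville1983, §9 Rem. 1 (`q(δ) = −2(r−1)`)] -/
theorem k3HilbertFormR_eq (a b : K3HilbertIndex → ℝ) :
    qR a b = k3FormR (fun i => a (Sum.inl i)) (fun i => b (Sum.inl i)) - 2 * (a (Sum.inr ()) * b (Sum.inr ())) := by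
  rw [k3HilbertFormR_apply, k3FormR_apply]
  simp only [Fintype.sum_sum_type, k3HilbertGram, Matrix.fromBlocks_apply₁₁, Matrix.fromBlocks_apply₁₂,
    Matrix.fromBlocks_apply₂₁, Matrix.fromBlocks_apply₂₂, Matrix.zero_apply, Matrix.of_apply, Int.cast_zero,
    mul_zero, zero_mul, Finset.sum_const_zero, add_zero, zero_add, Fintype.sum_unique, Int.cast_sub,
    Int.cast_mul, Int.cast_ofNat, Nat.cast_ofNat]
  ring

/-- `(t.t)_{Λ'} = (t|_Λ . t|_Λ)_Λ − 2 t_δ²`. [cite: Beauville1983, §9 Rem. 1] -/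
theorem k3HilbertFormR_self_eq (t : K3HilbertIndex → ℝ) :
    qR t t = k3FormR (fun i => t (Sum.inl i)) (fun i => t (Sum.inl i)) - 2 * t (Sum.inr ()) ^ 2 := by
  rw [k3HilbertFormR_eq, sq]

/-- The real `K3^{[2]}` form is symmetric. [folklore] -/
theorem k3HilbertFormR_comm (a b : K3HilbertIndex → ℝ) : qR a b = qR b a := by
  rw [k3HilbertFormR_eq, k3HilbertFormR_eq, k3FormR_comm, mul_comm (a (Sum.inr ()))]

/-- The complex `K3^{[2]}` form on real vectors is the real form. [folklore] -/
theorem k3HilbertForm_realCast (a b : K3HilbertIndex → ℝ) :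
    k3HilbertForm 2 (fun i => (a i : ℂ)) (fun i => (b i : ℂ)) = ((qR a b : ℝ) : ℂ) := by
  rw [k3HilbertFormR_apply, k3HilbertForm_apply]
  simp only [Complex.ofReal_sum, Complex.ofReal_mul, Complex.ofReal_intCast]

/-! ### The negative definite `20`-space -/

/-- Membership in `NΛ'`: the `Λ`-part lies in `ker negMap`. [folklore] -/
theorem mem_negSpace_iff (t : K3HilbertIndex → ℝ) :
    t ∈ NΛ' ↔ (fun i => t (Sum.inl i)) ∈ LinearMap.ker negMap := by
  rw [LinearMap.mem_ker, LinearMap.mem_ker, LinearMap.comp_apply]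
  rfl

/-- **`NΛ'` is negative semi-definite, and definite**: `(t.t) ≤ 0` on it, with equality only for `t = 0`.
[cite: Huybrechts2016K3, Ch. 1 Prop. 3.5] [cite: Beauville1983, §8 Thm. 5 (a)] -/
theorem k3HilbertFormR_self_of_mem_negSpace {t : K3HilbertIndex → ℝ} (ht : t ∈ NΛ') :
    qR t t ≤ 0 ∧ (qR t t = 0 → t = 0) := by
  obtain ⟨hle, hdef⟩ := k3FormR_self_of_mem_ker ((mem_negSpace_iff t).1 ht)
  have hsq := sq_nonneg (t (Sum.inr ()))
  rw [k3HilbertFormR_self_eq]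
  refine ⟨by linarith, fun h0 => ?_⟩
  have h1 : k3FormR (fun i => t (Sum.inl i)) (fun i => t (Sum.inl i)) = 0 := by linarith
  have h2 : t (Sum.inr ()) = 0 := by nlinarith
  have h3 := hdef h1
  funext i
  rcases i with i | i
  · exact congrFun h3 i
  · cases i
    exact h2

/-- `rk Λ'_ℝ = 23`. [cite: Beauville1983, §6 Prop. 6] -/
theorem finrank_k3HilbertReal : finrank ℝ (K3HilbertIndex → ℝ) = 23 := by
  rw [finrank_fintype_fun_eq_card]
  rfl

/-- `dim NΛ' ≥ 20` (rank–nullity: the map to `ℝ³` has rank `≤ 3`). [folklore] -/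
theorem le_finrank_negSpace : 20 ≤ finrank ℝ NΛ' := by
  have h := LinearMap.finrank_range_add_finrank_ker
    (negMap ∘ₗ LinearMap.funLeft ℝ ℝ (Sum.inl : K3Index → K3HilbertIndex))
  have hr : finrank ℝ (LinearMap.range
      (negMap ∘ₗ LinearMap.funLeft ℝ ℝ (Sum.inl : K3Index → K3HilbertIndex))) ≤ 3 := by
    have := Submodule.finrank_le (LinearMap.range
      (negMap ∘ₗ LinearMap.funLeft ℝ ℝ (Sum.inl : K3Index → K3HilbertIndex)))
    rwa [finrank_fintype_fun_eq_card, Fintype.card_fin] at this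
  rw [finrank_k3HilbertReal] at h
  omega

/-! ### Sylvester by hand: at most three positive directions -/

/-- **A real subspace of `Λ' ⊗ ℝ` on which the `K3^{[2]}` form is positive semi-definite has dimension
`≤ 3`** (signature `(3, 20)`): it meets the negative definite `20`-space `NΛ'` trivially, so
`dim W + 20 ≤ 23`. [cite: Beauville1983, §8 Thm. 5 (a)] [cite: Lang1987LinearAlgebra, Ch. V §8 Thm. 8.2] -/
theorem finrank_le_three_of_nonneg (W : Submodule ℝ (K3HilbertIndex → ℝ)) (hW : ∀ t ∈ W, 0 ≤ qR t t) :
    finrank ℝ W ≤ 3 := by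
  set K : Submodule ℝ (K3HilbertIndex → ℝ) := NΛ' with hKdef
  have hK : 20 ≤ finrank ℝ K := le_finrank_negSpace
  have hinf : W ⊓ K = ⊥ := by
    rw [eq_bot_iff]
    rintro t ⟨htW, htK⟩
    obtain ⟨hle, hdef⟩ := k3HilbertFormR_self_of_mem_negSpace htK
    rw [Submodule.mem_bot]
    exact hdef (le_antisymm hle (hW t htW))
  have hdim := Submodule.finrank_sup_add_finrank_inf_eq W K
  rw [hinf, finrank_bot, add_zero] at hdim
  have hle : finrank ℝ ↥(W ⊔ K) ≤ 23 := (Submodule.finrank_le _).trans_eq finrank_k3HilbertReal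
  omega

/-- **The real `K3^{[2]}` form is negative definite on the orthogonal complement of three pairwise
orthogonal positive vectors** (e.g. `Re z`, `Im z` and a Kähler class). [cite: Beauville1983, §8 Thm. 5 (a)] -/
theorem k3HilbertFormR_self_neg_of_orthogonal {p q r w : K3HilbertIndex → ℝ}
    (hp : 0 < qR p p) (hq : 0 < qR q q) (hr : 0 < qR r r)
    (hpq : qR p q = 0) (hpr : qR p r = 0) (hqr : qR q r = 0)
    (hwp : qR w p = 0) (hwq : qR w q = 0) (hwr : qR w r = 0) (hw : w ≠ 0) :
    qR w w < 0 := by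
  by_contra hww
  rw [not_lt] at hww
  have hqp : qR q p = 0 := by rw [k3HilbertFormR_comm, hpq]
  have hrp : qR r p = 0 := by rw [k3HilbertFormR_comm, hpr]
  have hrq : qR r q = 0 := by rw [k3HilbertFormR_comm, hqr]
  have hpw : qR p w = 0 := by rw [k3HilbertFormR_comm, hwp]
  have hqw : qR q w = 0 := by rw [k3HilbertFormR_comm, hwq]
  have hrw : qR r w = 0 := by rw [k3HilbertFormR_comm, hwr]
  let b : Fin 4 → (K3HilbertIndex → ℝ) := ![p, q, r, w]
  have hb0 : b 0 = p := rfl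
  have hb1 : b 1 = q := rfl
  have hb2 : b 2 = r := rfl
  have hb3 : b 3 = w := rfl
  -- the form is positive semi-definite on the span of `p, q, r, w`
  have hpos : ∀ t ∈ Submodule.span ℝ (Set.range b), 0 ≤ qR t t := by
    intro t ht
    obtain ⟨g, rfl⟩ := (Submodule.mem_span_range_iff_exists_fun ℝ).1 ht
    simp only [Fin.sum_univ_four, hb0, hb1, hb2, hb3, map_add, map_smul, LinearMap.add_apply,
      LinearMap.smul_apply, smul_eq_mul, hpq, hpr, hqr, hqp, hrp, hrq, hwp, hwq, hwr, hpw, hqw, hrw,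
      mul_zero, add_zero, zero_add]
    nlinarith [mul_nonneg (sq_nonneg (g 0)) hp.le, mul_nonneg (sq_nonneg (g 1)) hq.le,
      mul_nonneg (sq_nonneg (g 2)) hr.le, mul_nonneg (sq_nonneg (g 3)) hww]
  -- `p, q, r, w` are linearly independent
  have hli : LinearIndependent ℝ b := by
    rw [Fintype.linearIndependent_iff]
    intro g hg
    have eP := congrArg (fun t => qR t p) hg
    have eQ := congrArg (fun t => qR t q) hg
    have eR := congrArg (fun t => qR t r) hg
    simp only [Fin.sum_univ_four, hb0, hb1, hb2, hb3, map_add, map_smul, LinearMap.add_apply,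
      LinearMap.smul_apply, smul_eq_mul, hqp, hrp, hwp, hpq, hrq, hwq, hpr, hqr, hwr, mul_zero, add_zero,
      zero_add, map_zero, LinearMap.zero_apply] at eP eQ eR
    have g0 : g 0 = 0 := by
      rcases mul_eq_zero.1 eP with h | h
      · exact h
      · exact absurd h hp.ne'
    have g1 : g 1 = 0 := by
      rcases mul_eq_zero.1 eQ with h | h
      · exact h
      · exact absurd h hq.ne'
    have g2 : g 2 = 0 := by
      rcases mul_eq_zero.1 eR with h | h
      · exact h
      · exact absurd h hr.ne'
    have g3 : g 3 = 0 := by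
      simp only [Fin.sum_univ_four, hb0, hb1, hb2, hb3, g0, g1, g2, zero_smul, zero_add] at hg
      rcases smul_eq_zero.1 hg with h | h
      · exact h
      · exact absurd h hw
    intro i
    fin_cases i <;> assumption
  have hW : finrank ℝ (Submodule.span ℝ (Set.range b)) = 4 := by
    rw [finrank_span_eq_card hli, Fintype.card_fin]
  have h3 := finrank_le_three_of_nonneg _ hpos
  omega

/-- **No four pairwise orthogonal vectors of positive square in `Λ' ⊗ ℝ`.**
[cite: Beauville1983, §8 Thm. 5 (a)] -/
theorem not_four_orthogonal_pos_real (u : Fin 4 → (K3HilbertIndex → ℝ))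
    (hpos : ∀ i, 0 < qR (u i) (u i)) (horth : ∀ i j, i ≠ j → qR (u i) (u j) = 0) : False := by
  have h := k3HilbertFormR_self_neg_of_orthogonal (hpos 0) (hpos 1) (hpos 2)
    (horth 0 1 (by decide)) (horth 0 2 (by decide)) (horth 1 2 (by decide))
    (horth 3 0 (by decide)) (horth 3 1 (by decide)) (horth 3 2 (by decide))
    (fun h0 => by
      have h3 := hpos 3
      rw [h0] at h3
      simp at h3)
  exact lt_asymm h (hpos 3)

end Summit.HodgeConjecture.HodgeConjecture.Theorems.MarkmanPartnerTransport.PartnerExistenceSignature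

end
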